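import Literature.MathematicalPhysics.QuantumFieldTheory.Balaban1983to89.B7Eq43AveragedSmallnessLevelFree
import Literature.MathematicalPhysics.QuantumFieldTheory.Balaban1983to89.B9Eq315QTowerFlat

/-!
# `Balaban1983to89.B7Eq43AveragedSmallnessLinearFeed` — T. Bałaban, *Averaging operations for lattice gauge theories*, Commun. Math. Phys. **98** (1985) 17–51
# [Balaban1985Averaging] Prop. 2 (52)–(54) p. 26 with (42)–(43) pp. 23–24, read on the NE9 chain's torus tower in the currency of [Balaban1985BackgroundPropagators]
# (3.35)–(3.37) p. 396: **THE α-LINEAR TWO-WINDOW FEED** — from the two windows of (3.35) at a displayed parameter `α` (bonds `‖U(b) − 1‖ ≤ αη`, plaquettes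
# `‖U(∂p) − 1‖ ≤ αη²`, `ηL^{n+1} = 1`, `U` valued in an averaging-closed `S ≤ U1`), the WHOLE binder package of the chain's `k`-level diagonal theorems at the
# parameter `β = Kα`, `K = 1 + 512(d+1)(d+4)`: `U(b) ∈ U1`, the two windows at `β`, `Ū^j(b) ∈ U1`, and a level profile `εU ≥ 0` with `‖Ū^j(b) − 1‖ ≤ εU j`,
# `εU j ≤ β(1∕L)^j` — LINEAR IN `α` (the feed that LIPSCHITZ conclusions `≤ C·α·‖y‖` need; the sequel of this lineage's `B7Eq43AveragedSmallnessLevelFree`)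

statement-level skeleton of published theorems with citation tags; proofs where landed; nothing here is a claim about the Yang–Mills mass gap

CITATION HEADER (lean-in-tree rule).  Audit cell `pub-balaban`, sub-cell `t4`, BINDER row NE9; filed by NE9 formalisation-swarm leaf prover 03
(`b2b-balaban-t4-ne9-formalise-leaf-03`, gen 66), INTENT I-ne9leaf03-g66-A.  Sources READ in the held texts `paper:balaban1985-cmp99-background-propagators`
p. 396 ((3.35)–(3.37)) and [Balaban1985Averaging] pp. 24–26 via the tree's quoted ports (`B7Prop2Explicit`, `B7Eq47AveragedBondVsStraight`).  Objects BY NAME: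
`UlevOf`, `perCfg`, `pdev`, `AvgClosed`, `plaqHolU`; nothing re-declared, 0 `def`.

THE PRINT (verbatim).  [B9] p. 396 (3.35): *«|U(b) − 1| < α₀η, |U(∂p) − 1| < α₀η²»* (the two displays of the small-field class, per cube); (3.37): the averaged
configurations `Ū^j` over the domains `Ω_j` stay small; [B7] p. 26 (52)–(54): the class `|U(∂p) − 1| < α₀η²` is preserved by the averaging operation.

WHY THIS FILE (cell context).  `B7Eq43AveragedSmallnessLevelFree.exists_profile_of_windows_eta` inhabits the chain's level-profile binders
`εU ∕ hεU ∕ hUε ∕ hεg` from the two windows with the AREA constant `256(d+1)(d+4)·α₀′`, `α₀′` the CLASS parameter of (52) — a constant; the two-window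
re-issues built on it (`B9Thm311SmallFieldCoercivityTowerTwoWindows`, `B9Eq3153FrakGkBoundTwoWindows`) feed the owner's closed theorems at a FIXED parameter,
which is right for BOUNDS.  The energy storey's LIPSCHITZ letters (`B9Eq353FormDefectTowerDiagonal`, `B9Eq386GreenkLipschitzEnergyDiagonal`,
`B9Eq3126H1kLipschitzEnergyDiagonal`: conclusions `≤ C·α·‖y‖` with the SAME `α` as the windows and the profile) need the profile LINEAR in `α`.  This file:
for `α > 0` take the class parameter `2α` (`pdev Ũ ≤ αη² < 2αη²`), so the profile is `≤ ((1 + 512(d+1)(d+4))α∕L)(1∕L)^j ≤ Kα(1∕L)^j`; for `α = 0` the bond window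
forces `U ≡ 1`, every level background is `1` (`B9Eq315QTowerFlat.UlevOf_one`) and `εU ≡ 0` serves.

WHAT IS PROVED (sorry-free; proof lane — 0 `def`; [folklore] plumbing over landed letters).
* §1 **`profile_linear_of_pos`** — `0 < α`, `C₀(2α) ≤ ⅓`, `2(2α) ≤ c₂′`, the two windows at `α` ⇒ every `Ū^j(b) ∈ S` and `∃ εU ≥ 0` bounding every level bond with
  `εU j ≤ Kα(1∕L)^j` (`j < n+1`).
* §2 **`twoWindows_linear_feed`** — for `α₁ > 0`: `∃ T > 0` (`T = min(α₁∕K, 1∕(6C₀), c₂′∕4)`) such that for every `m, n`, `S`, `U : Bond(T_{L^{n+1}m}) → S`, `ηL^{n+1} = 1`,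
  `0 ≤ α ≤ T` and the two windows at `α`: `0 ≤ Kα ≤ α₁`, `U(b) ∈ U1`, the two windows at `Kα`, `Ū^j(b) ∈ U1` (all `j, b`), and a profile `εU ≥ 0` with
  `‖Ū^j(b) − 1‖ ≤ εU j` (all `j, b`), `εU j ≤ Kα(1∕L)^j` (`j < n+1`) — the binders `hUb ∕ hUη ∕ hpl ∕ hLb ∕ εU ∕ hεU ∕ hUε ∕ hεg ∕ (α ≤ α₁)` of the owner's diagonal
  theorems AT ONE PARAMETER `β = Kα`.
HONEST SCOPE.  [folklore]; nothing of [B7] Prop. 2 ∕ [B9] asserted hypothesis-free; the fine-bond window is NOT derived from the plaquette window (torus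
holonomies; print's (3.35) is per cube — the IMS road); NOT summit progress (cell pub-balaban: NE9 NOT PRINTED ∕ NOT PROVED; «NE9 ⇐ the named binders»; spine
PROVED 0/9; rung (B)+1 finite T⁴ — NOT infinite volume, NOT mass gap, NOT Clay; HONEST DEPENDENCY: continuum YM on T⁴ ⇐ BetaPertH ∧ nine spine estimates
(0/9 proved); BetaPertH ⇐ (D1) ∧ (D4) ∧ CAP+tail; G-an2-4 gates asym, D1 and NE2/3/4).  NEW file; nothing modified.  Net new unproved facts: 0.
-/

noncomputable section

open scoped BigOperators

namespace Literature.MathematicalPhysics.QuantumFieldTheory.Balaban1983to89.B7Eq43AveragedSmallnessLinearFeed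

open B9SectCLatticeCarrier (Bond)
open B7Prop1Explicit (U1)
open B7Prop2Explicit (pdev C0 c2' AvgClosed C0_pos c2'_pos)
open B9Eq315QTorus (perCfg)
open B9Eq315QTower (towerP UlevOf)
open B9Eq315QTowerFlat (UlevOf_one)
open B9Eq310DeltaPrime (plaqHolU plaqHolU_one)
open B7Eq43AveragedSmallnessLevelFree (exists_profile_of_windows_eta UlevOf_mem pdev_perCfg_le_of_plaq)

variable {d : ℕ} (L : ℕ) [NeZero L] (hL : 2 ≤ L) {𝔸 : Type*} [NormedRing 𝔸] [NormOneClass 𝔸] [NormedAlgebra ℂ 𝔸] [CompleteSpace 𝔸]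

/-! ## §1 The feed at a positive window parameter: class constant `2α` -/

include hL in
/-- **THE PROFILE IS LINEAR IN THE WINDOW PARAMETER**: for `0 < α` with `C₀(2α) ≤ ⅓`, `2(2α) ≤ c₂′`, an averaging-closed `S`, `U : Bond(T_{L^{n+1}m}) → S`,
`ηL^{n+1} = 1` and the two windows `‖U(b) − 1‖ ≤ αη`, `‖U(∂p) − 1‖ ≤ αη²`: every level background is `S`-valued and there is `εU ≥ 0` with
`‖Ū^j(b) − 1‖ ≤ εU j` (all `j, b`) and `εU j ≤ (1 + 512(d+1)(d+4))·α·(1∕L)^j` (`j < n+1`) — the class (52) entered at the parameter `2α > pdev Ũ·N²`.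
[cite: Balaban1985Averaging, Prop. 2 (52)–(54) p.26, (42)–(43) pp.23–24; Balaban1985BackgroundPropagators, (3.35)–(3.37) p.396] -/
theorem profile_linear_of_pos (m : Fin d → ℕ) [∀ i, NeZero (m i)] (n : ℕ) {S : Subgroup 𝔸ˣ} (hS : AvgClosed d L S)
    {U : Bond d (towerP L m (n + 1)) → 𝔸ˣ} (hU : ∀ b, U b ∈ S) {α η : ℝ} (hα : 0 < α) (h3 : C0 d * (2 * α) ≤ 1 / 3) (h2 : 2 * (2 * α) ≤ c2' d L)
    (hηL : η * (L : ℝ) ^ (n + 1) = 1) (hUη : ∀ b, ‖(U b : 𝔸) - 1‖ ≤ α * η)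
    (hpl : ∀ p : B9SectCLatticeCarrier.Plaq d (towerP L m (n + 1)), ‖(plaqHolU U p : 𝔸) - 1‖ ≤ α * η ^ 2) :
    (∀ (j : ℕ) (b : Bond d (towerP L m (j + 1))), UlevOf L m (n + 1) U j b ∈ S) ∧
      ∃ εU : ℕ → ℝ, (∀ j, 0 ≤ εU j) ∧ (∀ (j : ℕ) (b : Bond d (towerP L m (j + 1))), ‖(UlevOf L m (n + 1) U j b : 𝔸) - 1‖ ≤ εU j) ∧
        ∀ j < n + 1, εU j ≤ (1 + 512 * (d + 1) * (d + 4)) * α * (1 / (L : ℝ)) ^ j := by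
  have hL0 : (0 : ℝ) < L := by exact_mod_cast lt_of_lt_of_le (by norm_num) hL
  have hL1 : (1 : ℝ) ≤ L := by exact_mod_cast le_trans (by norm_num) hL
  have hN : (0 : ℝ) < (L : ℝ) ^ (n + 1) := pow_pos hL0 _
  have hη : η = ((L : ℝ) ^ (n + 1))⁻¹ := (inv_eq_of_mul_eq_one_left hηL).symm
  have h2α : 0 < 2 * α := by positivity
  -- the class (52) at the parameter `2α`
  have hU1 : ∀ b, U b ∈ U1 𝔸 := fun b => hS.le_U1 (hU b)
  have hpd : pdev (perCfg (towerP L m (n + 1)) U) ≤ α * η ^ 2 := pdev_perCfg_le_of_plaq (U := U) hU1 (by positivity) hpl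
  have h52 : pdev (perCfg (towerP L m (n + 1)) U) < 2 * α * (((L : ℝ) ^ (n + 1))⁻¹) ^ 2 := by
    refine lt_of_le_of_lt hpd ?_
    rw [hη]
    exact mul_lt_mul_of_pos_right (by linarith) (by positivity)
  refine ⟨fun j b => UlevOf_mem L m n hL hS hU h2α h3 h2 h52 j b, ?_⟩
  obtain ⟨εU, hεU, hUε, hεg⟩ := exists_profile_of_windows_eta L m n hL hS hU h2α h3 h2 hηL hα.le (by linarith) hUη hpl
  refine ⟨εU, hεU, hUε, fun j hj => (hεg j hj).trans ?_⟩
  have hK : α + 256 * (d + 1) * (d + 4) * (2 * α) = (1 + 512 * (d + 1) * (d + 4)) * α := by ring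
  rw [hK]
  exact mul_le_mul_of_nonneg_right (div_le_self (by positivity) hL1) (by positivity)

/-! ## §2 The feed for `0 ≤ α ≤ T`: the binder package of the owner's diagonal theorems at `β = Kα` -/

include hL in
/-- **THE α-LINEAR TWO-WINDOW FEED**: for `α₁ > 0` there is `T > 0` (`T = min(α₁∕K, 1∕(6C₀), c₂′∕4)`, `K = 1 + 512(d+1)(d+4)`) such that for every `m, n`, every
averaging-closed `S`, `U : Bond(T_{L^{n+1}m}) → S`, `ηL^{n+1} = 1`, `0 ≤ α ≤ T` and the two windows `‖U(b) − 1‖ ≤ αη`, `‖U(∂p) − 1‖ ≤ αη²`: with `β = Kα`,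
`0 ≤ β ≤ α₁`, `U(b) ∈ U1`, `‖U(b) − 1‖ ≤ βη`, `‖U(∂p) − 1‖ ≤ βη²`, `Ū^j(b) ∈ U1` (all `j, b`), and `∃ εU ≥ 0` with `‖Ū^j(b) − 1‖ ≤ εU j` (all `j, b`),
`εU j ≤ β(1∕L)^j` (`j < n+1`) — every small-field binder of the chain's `k`-level diagonal theorems at ONE parameter, linear in the displayed `α`
(`α = 0`: the bond window forces `U ≡ 1`, `εU ≡ 0`). [cite: Balaban1985Averaging, Prop. 2 (52)–(54) p.26; Balaban1985BackgroundPropagators, (3.35)–(3.37) p.396] -/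
theorem twoWindows_linear_feed {α₁ : ℝ} (hα₁ : 0 < α₁) :
    ∃ T : ℝ, 0 < T ∧ ∀ (m : Fin d → ℕ) [∀ i, NeZero (m i)] (n : ℕ) {S : Subgroup 𝔸ˣ}, AvgClosed d L S →
      ∀ {U : Bond d (towerP L m (n + 1)) → 𝔸ˣ}, (∀ b, U b ∈ S) → ∀ {α η : ℝ}, η * (L : ℝ) ^ (n + 1) = 1 → 0 ≤ α → α ≤ T →
      (∀ b, ‖(U b : 𝔸) - 1‖ ≤ α * η) → (∀ p : B9SectCLatticeCarrier.Plaq d (towerP L m (n + 1)), ‖(plaqHolU U p : 𝔸) - 1‖ ≤ α * η ^ 2) →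
      0 ≤ (1 + 512 * (d + 1) * (d + 4)) * α ∧ (1 + 512 * (d + 1) * (d + 4)) * α ≤ α₁ ∧ (∀ b, U b ∈ U1 𝔸) ∧
        (∀ b, ‖(U b : 𝔸) - 1‖ ≤ (1 + 512 * (d + 1) * (d + 4)) * α * η) ∧
        (∀ p : B9SectCLatticeCarrier.Plaq d (towerP L m (n + 1)), ‖(plaqHolU U p : 𝔸) - 1‖ ≤ (1 + 512 * (d + 1) * (d + 4)) * α * η ^ 2) ∧
        (∀ (j : ℕ) (b : Bond d (towerP L m (j + 1))), UlevOf L m (n + 1) U j b ∈ U1 𝔸) ∧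
        ∃ εU : ℕ → ℝ, (∀ j, 0 ≤ εU j) ∧ (∀ (j : ℕ) (b : Bond d (towerP L m (j + 1))), ‖(UlevOf L m (n + 1) U j b : 𝔸) - 1‖ ≤ εU j) ∧
          ∀ j < n + 1, εU j ≤ (1 + 512 * (d + 1) * (d + 4)) * α * (1 / (L : ℝ)) ^ j := by
  have hL0 : (0 : ℝ) < L := by exact_mod_cast lt_of_lt_of_le (by norm_num) hL
  have hC0 := C0_pos d
  have hc2 := c2'_pos d L (le_trans (by norm_num) hL)
  obtain ⟨K, hKdef⟩ : ∃ K : ℝ, K = 1 + 512 * (d + 1) * (d + 4) := ⟨_, rfl⟩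
  have hK1 : 1 ≤ K := by
    have h0 : (0 : ℝ) ≤ 512 * (d + 1) * (d + 4) := by positivity
    rw [hKdef]; linarith
  have hK0 : 0 < K := lt_of_lt_of_le one_pos hK1
  rw [← hKdef]
  refine ⟨min (α₁ / K) (min (1 / (6 * C0 d)) (c2' d L / 4)), lt_min (by positivity) (lt_min (by positivity) (by positivity)), ?_⟩
  intro m _ n S hS U hU α η hηL hα0 hαle hUη hpl
  have hαK : α ≤ α₁ / K := hαle.trans (min_le_left _ _)
  have hα3 : α ≤ 1 / (6 * C0 d) := hαle.trans ((min_le_right _ _).trans (min_le_left _ _))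
  have hα2 : α ≤ c2' d L / 4 := hαle.trans ((min_le_right _ _).trans (min_le_right _ _))
  have hβ0 : 0 ≤ K * α := by positivity
  have hβ1 : K * α ≤ α₁ := by rw [mul_comm]; rwa [le_div_iff₀ hK0] at hαK
  have hηL0 : 0 < η * (L : ℝ) ^ (n + 1) := by rw [hηL]; exact one_pos
  have hη0 : 0 < η := pos_of_mul_pos_left hηL0 (pow_pos hL0 _).le
  rcases hα0.eq_or_lt with hαz | hαp
  · -- `α = 0`: the bond window forces `U ≡ 1`
    subst hαz
    have hU1 : U = fun _ => 1 := by
      funext b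
      have h := hUη b
      rw [zero_mul, norm_le_zero_iff, sub_eq_zero] at h
      exact Units.ext h
    subst hU1
    refine ⟨hβ0, hβ1, fun _ => Subgroup.one_mem _, fun b => ?_, fun p => ?_, fun j b => ?_, fun _ => 0, fun _ => le_rfl, fun j b => ?_, fun j _ => ?_⟩
    · rw [Units.val_one, sub_self, norm_zero]; positivity
    · rw [plaqHolU_one, Units.val_one, sub_self, norm_zero]; positivity
    · rw [UlevOf_one]; exact Subgroup.one_mem _
    · rw [UlevOf_one, Units.val_one, sub_self, norm_zero]
    · positivity
  · -- `0 < α`: the class at `2α`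
    have h3 : C0 d * (2 * α) ≤ 1 / 3 := by
      have h := mul_le_mul_of_nonneg_left hα3 hC0.le
      rw [mul_one_div, show C0 d / (6 * C0 d) = 1 / 6 by field_simp] at h
      linarith
    have h2 : 2 * (2 * α) ≤ c2' d L := by linarith
    obtain ⟨hLS, εU, hεU, hUε, hεg⟩ := profile_linear_of_pos L hL m n hS hU hαp h3 h2 hηL hUη hpl
    rw [← hKdef] at hεg
    have hαβ : α ≤ K * α := le_mul_of_one_le_left hαp.le hK1
    refine ⟨hβ0, hβ1, fun b => hS.le_U1 (hU b), fun b => (hUη b).trans (mul_le_mul_of_nonneg_right hαβ hη0.le),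
      fun p => (hpl p).trans (mul_le_mul_of_nonneg_right hαβ (sq_nonneg η)), fun j b => hS.le_U1 (hLS j b), εU, hεU, hUε, hεg⟩

end Literature.MathematicalPhysics.QuantumFieldTheory.Balaban1983to89.B7Eq43AveragedSmallnessLinearFeed

end
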